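import Summits.CriticalPhenomena.PercolationContinuityZ3.Theorems.PercNearOneGluingNoHeavyLowerTailMajorityGluingQCertCountK
import Summits.CriticalPhenomena.PercolationContinuityZ3.Theorems.PercNearOneGluingNoHeavyLowerTailMajorityGluingQCertSevenFive3
import HarnessLib

/-!
# Five of seven relays cut from the hub: `μ ≤ (61/50)·max_i μ(vᵢ ↮ a₀)` by a kernel-checked certificate; `C(9) ≤ 111/50`, and `= 2` for `max ≥ 11/61` (lane prim-rate, constants-miner 1, gen 34; CANDIDATES §GEN-34 R327)

Support file for the closed crux `NoHeavyLowerTail` (stmt-CriticalPhenomena-4575), majority-gluing line.  The cell `(7,5)` of `|A| = 9` gets its OWN certificate (kit j269835: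
degree-2, case family `A`, tight van den Berg–Kahn classes with up to 420 members; the floor of that language at `(7,5)` lies in `(1.18, 1.22]`; programme value `1.0908`):
**`fiveOfSeven_cert` : `μ(5 ≤ #{v ∈ T : v ↮ a₀}) ≤ (61/50)·δ`** for every finite weighted graph, hub `a₀`, `7`-set `T` and `δ ≥` the cut probabilities — an instance of the generic
`cut_of_check_count` (`…QCertCountK`) at the passing certificate `sevenFive`.  Consequences via the generic Harris layer of `…MajorityGluingEightHarris` (cell `(7,5)` is exactly
the cell of `|A| = 9`): **`majorityGluing_card_nine_cert` : `C(9) ≤ 111/50 = 2.22`** (was `113/50` from `(6,4)` by monotonicity), **`majorityGluing_two_card_nine_of_ge_cert` :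
`C(9) = 2` whenever `max ≥ 11/61 ≈ 0.180`**, and the Harris form `δ₀ + (61/50)δ₀(1 − δ₀)`.  No sorries.
[cite: VandenbergKahn2001, Thm 1.2 (p. 123)] [cite: KozmaNitzan2024, Conj. 1 (p. 3), Conj. 4 (p. 32)]
-/

noncomputable section

namespace Summit.CriticalPhenomena.PercolationContinuityZ3.Theorems

open MeasureTheory Set
open Literature.Probability.LatticeModels (prodBernoulli)
open Literature.Probability.Percolation
open scoped Classical

namespace HubOnly

variable {n : ℕ}

/-- **AT LEAST FIVE OF SEVEN RELAYS CUT: `μ ≤ (61/50)·δ`** for every finite weighted graph, hub `a₀`, `7`-set `T` and `δ` bounding the seven cut probabilities — the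
kernel-checked certificate `QCert.sevenFive`. [cite: VandenbergKahn2001, Thm 1.2 (p. 123)] -/
theorem fiveOfSeven_cert (w : Sym2 (Fin n) → unitInterval) (a₀ : Fin n) (T : Finset (Fin n)) (hT : T.card = 7) (δ : ℝ)
    (hδ : ∀ v ∈ T, (prodBernoulli w).real (openConn v a₀ : Set (BondConfig (Fin n)))ᶜ ≤ δ) :
    (prodBernoulli w).real {ω : BondConfig (Fin n) | 5 ≤ (T.filter fun v => ω ∉ openConn v a₀).card} ≤ 61 / 50 * δ := by
  obtain ⟨v, hv⟩ : T.Nonempty := by rw [← Finset.card_pos, hT]; norm_num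
  have hδ0 : 0 ≤ δ := le_trans measureReal_nonneg (hδ v hv)
  have h := QCert.cut_of_check_count QCert.sevenFive rfl rfl QCert.sevenFive_check w a₀ T hT δ hδ0 hδ
  have hcD : (QCert.sevenFive.cD : ℝ) = 50 := by norm_num [QCert.sevenFive]
  have hcN : (QCert.sevenFive.cN : ℝ) = 61 := by norm_num [QCert.sevenFive]
  have hh : QCert.sevenFive.h = 5 := rfl
  rw [hcD, hcN, hh] at h
  linarith

/-- The cell of `|A| = 9` obeys the constant bound `(61/50)·δ`. [cite: VandenbergKahn2001, Thm 1.2 (p. 123)] -/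
theorem cell_nine_cert (p : Sym2 (Fin n) → unitInterval) (A : Finset (Fin n)) (a₀ : Fin n) (h9 : A.card = 9)
    (T : Finset (Fin n)) (δ : ℝ) (_haT : a₀ ∉ T) (_hTA : T ⊆ A) (hTcard : T.card + 2 = A.card) (_hδ : 0 ≤ δ)
    (hδT : ∀ v ∈ T, (prodBernoulli p).real (openConn v a₀ : Set (BondConfig (Fin n)))ᶜ ≤ δ) :
    (prodBernoulli p).real {ω : BondConfig (Fin n) | (A.card + 1) / 2 ≤ (T.filter fun v => ω ∉ openConn v a₀).card} ≤ 61 / 50 * δ := by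
  have hT : T.card = 7 := by omega
  have h5 : (A.card + 1) / 2 = 5 := by omega
  rw [h5]
  exact fiveOfSeven_cert p a₀ T hT δ hδT

/-- **MAJORITY GLUING AT `|A| = 9` WITH LOSS `(111/50)·max`:** `μ(o ↔ A) − (111/50)δ₀ ≤ μ(o ↔ a₀ ∧ 2N > 9)` for every weight function, observer, hub `a₀ ∈ A`, `|A| = 9`,
`δ₀ ≥ max_{a∈A} μ(a ↮ a₀)` (was `113/50`). [cite: VandenbergKahn2001, Thm 1.2 (p. 123)] [cite: KozmaNitzan2024, Conj. 1 (p. 3)] -/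
theorem majorityGluing_card_nine_cert (w : Sym2 (Fin n) → unitInterval) (A : Finset (Fin n)) (o a₀ : Fin n) (δ₀ : ℝ)
    (ha₀ : a₀ ∈ A) (h9 : A.card = 9)
    (hδ₀ : ∀ a ∈ A, (prodBernoulli w).real (openConn a a₀ : Set (BondConfig (Fin n)))ᶜ ≤ δ₀) :
    (prodBernoulli w).real (⋃ a ∈ A, openConn o a) - 111 / 50 * δ₀ ≤
      (prodBernoulli w).real {ω : BondConfig (Fin n) | ω ∈ openConn o a₀ ∧
          A.card < 2 * (A.filter fun a => ω ∈ openConn o a).card} := by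
  have h := majorityGluing_of_cellConst w A o a₀ δ₀ ha₀ (by omega) (61 / 50) (by norm_num)
    (fun p _ T δ haT hTA hTcard hδ hδT => cell_nine_cert p A a₀ h9 T δ haT hTA hTcard hδ hδT) hδ₀
  norm_num at h ⊢
  linarith

/-- **MAJORITY GLUING AT `|A| = 9`, HARRIS FORM:** loss `δ₀ + (61/50)·δ₀·(1 − δ₀)` for `max_{a∈A} μ(a ↮ a₀) ≤ δ₀ ≤ 50/61`.
[cite: VandenbergKahn2001, Thm 1.2 (p. 123)] [cite: KozmaNitzan2024, Conj. 1 (p. 3)] -/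
theorem majorityGluing_harris_card_nine_cert (w : Sym2 (Fin n) → unitInterval) (A : Finset (Fin n)) (o a₀ : Fin n) (δ₀ : ℝ)
    (ha₀ : a₀ ∈ A) (h9 : A.card = 9)
    (hδ₀ : ∀ a ∈ A, (prodBernoulli w).real (openConn a a₀ : Set (BondConfig (Fin n)))ᶜ ≤ δ₀) (hδ₀' : δ₀ ≤ 50 / 61) :
    (prodBernoulli w).real (⋃ a ∈ A, openConn o a) -
        (prodBernoulli w).real {ω : BondConfig (Fin n) | ω ∈ openConn o a₀ ∧
          A.card < 2 * (A.filter fun a => ω ∈ openConn o a).card}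
      ≤ δ₀ + 61 / 50 * δ₀ * (1 - δ₀) :=
  majorityGluing_harris_of_cellConst w A o a₀ δ₀ ha₀ (by omega) (61 / 50) (by norm_num)
    (fun p _ T δ haT hTA hTcard hδ hδT => cell_nine_cert p A a₀ h9 T δ haT hTA hTcard hδ hδT) hδ₀ (by linarith)

/-- **`C(9) = 2` WHENEVER `max ≥ 11/61`:** `μ(o ↔ A) − 2δ₀ ≤ μ(o ↔ a₀ ∧ 2N > 9)` for `|A| = 9`, `δ₀ ≥ max_{a∈A} μ(a ↮ a₀)`, `δ₀ ≥ 11/61` (was `13/63`).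
[cite: VandenbergKahn2001, Thm 1.2 (p. 123)] [cite: KozmaNitzan2024, Conj. 1 (p. 3), Conj. 4 (p. 32)] -/
theorem majorityGluing_two_card_nine_of_ge_cert (w : Sym2 (Fin n) → unitInterval) (A : Finset (Fin n)) (o a₀ : Fin n) (δ₀ : ℝ)
    (ha₀ : a₀ ∈ A) (h9 : A.card = 9)
    (hδ₀ : ∀ a ∈ A, (prodBernoulli w).real (openConn a a₀ : Set (BondConfig (Fin n)))ᶜ ≤ δ₀) (h1161 : 11 / 61 ≤ δ₀) :
    (prodBernoulli w).real (⋃ a ∈ A, openConn o a) - 2 * δ₀ ≤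
      (prodBernoulli w).real {ω : BondConfig (Fin n) | ω ∈ openConn o a₀ ∧
          A.card < 2 * (A.filter fun a => ω ∈ openConn o a).card} :=
  majorityGluing_two_of_cellConst w A o a₀ δ₀ ha₀ (by omega) (61 / 50) (by norm_num)
    (fun p _ T δ haT hTA hTcard hδ hδT => cell_nine_cert p A a₀ h9 T δ haT hTA hTcard hδ hδT) hδ₀ (by linarith)

end HubOnly

end Summit.CriticalPhenomena.PercolationContinuityZ3.Theorems

end
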